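import Summits.Ventures.GridStability.Bench.SMIBDeg6AK13postD10Data2
import Mathlib.Tactic.LinearCombination
import Mathlib.Tactic.Positivity
import HarnessLib
-- PORT cert/sos-5/emit_lean.py@20ae4a4141729553 / source cert/A/SMIB-deg6-A-K13postD10.json sha256: ee9fd533380ca3531ac6ff2022109fa3a05e578218eea1b2dbcb77d6d487c5ac
-- estimated kernel time of this file's `decide`s: 200 s (emitter calibration 2026-08-26; RULING 8 budget 330 s per file)

/-!
# Ventures/GridStability — Bench/SMIBDeg6AK13postD10Part1.lean: PART 1 of 2 of certificate file `SMIB-deg6-A-K13postD10` (system SMIB, V degree 6, toolchain A)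

Kernel checks and certified inequalities for the identities `deg6_A_K13postD10_V_pos`,
`deg6_A_K13postD10_Vdot_neg` of certificate `SMIB-deg6-A-K13postD10` (data in
`Summits.Ventures.GridStability.Bench.SMIBDeg6AK13postD10Data`); the conjunction
`deg6_A_K13postD10_certificate` and the full docstring (three columns, provenance, identity list)
are in `Bench/SMIBDeg6AK13postD10.lean`. Split by the emitter so that each file's `decide +kernel`
time stays inside the RULING 8 budget (estimated 200 s here). «algebraic inequalities certified; ROA
inclusion pending Lyapunov/ lemma».
-/

namespace Summit.Ventures.GridStability.Bench.SMIB

open Literature.Computation.Certificates Literature.Computation.Certificates.SOS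
open Literature.Computation.Certificates.SOS.Poly

/-! ### Kernel checks (`decide +kernel`) — data in `Summits.Ventures.GridStability.Bench.SMIBDeg6AK13postD10Data` -/

set_option maxHeartbeats 0 in
/-- KERNEL CHECK `deg6_A_K13postD10_V_pos`: every Gram block passes `PSD.IsGramCertDD` and the residual `p − (σ₀ + Σ gᵢσᵢ + Σ hⱼtⱼ)` is the zero polynomial (`SOS.Poly.checkG`, ONE reduction). [folklore] -/
theorem deg6_A_K13postD10_V_pos_check : checkG deg6_A_K13postD10_V_pos_p deg6_A_K13postD10_V_pos_gs deg6_A_K13postD10_V_pos_hs deg6_A_K13postD10_V_pos_cert = true := by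
  decide +kernel

set_option maxHeartbeats 0 in
/-- KERNEL CHECK `deg6_A_K13postD10_Vdot_neg`: every Gram block passes `PSD.IsGramCertDD` and the residual `p − (σ₀ + Σ gᵢσᵢ + Σ hⱼtⱼ)` is the zero polynomial (`SOS.Poly.checkG`, ONE reduction). [folklore] -/
theorem deg6_A_K13postD10_Vdot_neg_check : checkG deg6_A_K13postD10_Vdot_neg_p deg6_A_K13postD10_Vdot_neg_gs deg6_A_K13postD10_Vdot_neg_hs deg6_A_K13postD10_Vdot_neg_cert = true := by
  decide +kernel

/-! ### The certified inequalities (README §3 T3; «algebraic inequalities certified; ROA inclusion pending Lyapunov/ lemma») -/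

/-- **`deg6_A_K13postD10_V_pos`** (CERTIFIED, model `SMIB instance SMIB-K13post-D10 (model-1 I2 file, f
verbatim)`; ALGEBRAIC inequality, ROA inclusion pending Lyapunov/ lemma): V - eps_pos*phi >= 0 on {h
= 0} — for every real point satisfying the listed hypotheses (hh). [folklore] -/
theorem deg6_A_K13postD10_V_pos (sigma kappa omega : ℝ) (hh : deg6_A_K13postD10_h sigma kappa omega = 0) :
    (1 / 100 : ℝ) * (((1 : ℝ) / 36) * omega ^ 2 + (1 : ℝ) * kappa ^ 2 + (1 : ℝ) * sigma ^ 2) ≤ deg6_A_K13postD10_V sigma kappa omega := by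
  simp only [deg6_A_K13postD10_V, deg6_A_K13postD10_V_poly, eval_cons, eval_nil, Monomial.eval_eq, Monomial.evalFrom_cons, Monomial.evalFrom_nil,
        vars_cons_zero, vars_cons_succ]
  push_cast
  simp only [deg6_A_K13postD10_h, deg6_A_K13postD10_h_poly, eval_cons, eval_nil, Monomial.eval_eq, Monomial.evalFrom_cons, Monomial.evalFrom_nil,
        vars_cons_zero, vars_cons_succ] at hh
  push_cast at hh
  have h := nonneg_of_checkG deg6_A_K13postD10_V_pos_check (vars [sigma, kappa, omega])
    (by simp [deg6_A_K13postD10_V_pos_gs])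
    (by
      intro q hq
      simp only [deg6_A_K13postD10_V_pos_hs, List.mem_cons, List.not_mem_nil, or_false] at hq
      rcases hq with rfl
      · simp only [eval_cons, eval_nil, Monomial.eval_eq, Monomial.evalFrom_cons, Monomial.evalFrom_nil,
        vars_cons_zero, vars_cons_succ]
        push_cast
        linear_combination hh)
  simp only [deg6_A_K13postD10_V_pos_p, eval_cons, eval_nil, Monomial.eval_eq, Monomial.evalFrom_cons, Monomial.evalFrom_nil,
        vars_cons_zero, vars_cons_succ] at h
  push_cast at h
  linear_combination h

/-- **`deg6_A_K13postD10_Vdot_neg`** (CERTIFIED, model `SMIB instance SMIB-K13post-D10 (model-1 I2 file,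
f verbatim)`; ALGEBRAIC inequality, ROA inclusion pending Lyapunov/ lemma): -Vdot - eps_dot*phi >= 0
on {level - V >= 0} cap {r2 - phi >= 0} cap {h = 0} (Vdot = grad V . f; the ball hypothesis is D
itself and is implied on {V <= level} cap {h=0} by level_in_ball) — for every real point satisfying
the listed hypotheses (hV, hD1, hh). [folklore] -/
theorem deg6_A_K13postD10_Vdot_neg (sigma kappa omega : ℝ) (hV : deg6_A_K13postD10_V sigma kappa omega ≤ (17 / 7 : ℝ)) (hD1 : 0 ≤ ((-1 : ℝ) / 36) * omega ^ 2 + (-1 : ℝ) * kappa ^ 2 + (-1 : ℝ) * sigma ^ 2 + (1 : ℝ)) (hh : deg6_A_K13postD10_h sigma kappa omega = 0) :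
    deg6_A_K13postD10_Vdot sigma kappa omega ≤ -(1 / 2000 : ℝ) * (((1 : ℝ) / 36) * omega ^ 2 + (1 : ℝ) * kappa ^ 2 + (1 : ℝ) * sigma ^ 2) := by
  simp only [deg6_A_K13postD10_Vdot, deg6_A_K13postD10_Vdot_poly, eval_cons, eval_nil, Monomial.eval_eq, Monomial.evalFrom_cons, Monomial.evalFrom_nil,
        vars_cons_zero, vars_cons_succ]
  push_cast
  simp only [deg6_A_K13postD10_V, deg6_A_K13postD10_V_poly, eval_cons, eval_nil, Monomial.eval_eq, Monomial.evalFrom_cons, Monomial.evalFrom_nil,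
        vars_cons_zero, vars_cons_succ] at hV
  push_cast at hV
  simp only [deg6_A_K13postD10_h, deg6_A_K13postD10_h_poly, eval_cons, eval_nil, Monomial.eval_eq, Monomial.evalFrom_cons, Monomial.evalFrom_nil,
        vars_cons_zero, vars_cons_succ] at hh
  push_cast at hh
  have h := nonneg_of_checkG deg6_A_K13postD10_Vdot_neg_check (vars [sigma, kappa, omega])
    (by
      intro g hg
      simp only [deg6_A_K13postD10_Vdot_neg_gs, List.mem_cons, List.not_mem_nil, or_false] at hg
      rcases hg with rfl | rfl
      · simp only [eval_cons, eval_nil, Monomial.eval_eq, Monomial.evalFrom_cons, Monomial.evalFrom_nil,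
        vars_cons_zero, vars_cons_succ]
        push_cast
        linear_combination hV
      · simp only [eval_cons, eval_nil, Monomial.eval_eq, Monomial.evalFrom_cons, Monomial.evalFrom_nil,
        vars_cons_zero, vars_cons_succ]
        push_cast
        linear_combination hD1)
    (by
      intro q hq
      simp only [deg6_A_K13postD10_Vdot_neg_hs, List.mem_cons, List.not_mem_nil, or_false] at hq
      rcases hq with rfl
      · simp only [eval_cons, eval_nil, Monomial.eval_eq, Monomial.evalFrom_cons, Monomial.evalFrom_nil,
        vars_cons_zero, vars_cons_succ]
        push_cast
        linear_combination hh)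
  simp only [deg6_A_K13postD10_Vdot_neg_p, eval_cons, eval_nil, Monomial.eval_eq, Monomial.evalFrom_cons, Monomial.evalFrom_nil,
        vars_cons_zero, vars_cons_succ] at h
  push_cast at h
  linear_combination h

end Summit.Ventures.GridStability.Bench.SMIB
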